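import Summits.CriticalPhenomena.Ising3D.TaylorRegionDeltaEven
import Mathlib.Tactic.Linarith
import Mathlib.Tactic.Positivity
import Mathlib.Tactic.Ring
import HarnessLib

/-!
# Term enclosures for δ-row triples and affine positivity tests with interval scalars (item (L4), part 1: the tools of the
wide-box odd cone; HOME/pub-ising3x-recog-1/gen12/REGION-ON-MARGIN-FUNCTIONAL.md §5–§6)
(cell `pub-ising3x`, seat recog-1 gen 12; gate (g2))

HONEST FRAMING: lottery ticket; floor = tightest certified 3D Ising CFT bounds; no exact-solution
claim without a proof. Island framing: certified exclusion region at stated derivative order and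
assumptions; not a determination of the 3D Ising critical exponents beyond that.

The odd rows `M± = ψ̂₀ ∓ K₁ q̂₃`, `R± = q̂₄ − q̂₅ ∓ (κ₀/2) K₂ q̂₃ − (κ₀⁻¹/2) K₃ ψ̂_t` mix components with DIFFERENT exponents (`q̂₃` at
the mean `b₀ ± Wb`, `q̂₄, q̂₅` at `σ₀ ± Wσ`, `ψ̂_t` at `t₀ ± Wt`, `ψ̂₀` exact) and interval box scalars `K₁, K₂, K₃`. Each term is
enclosed on the piece from its own δ-row triple (`lowB3` / `hiB3`, scale `S`), THEN multiplied by its interval scalar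
(`mulLo`, scale `S²`) and summed (`affine2_pos`, `affine4_pos`) — multiplying the scalars into the rows before the shift would
re-introduce the cancellation loss. This file: **`hiB`** (+`le_hiB`, mirror of `lowB`), **`hiB3`** (+`le_hiB3`), `lowB3_le'`,
**`mulLo`** (+`mulLo_le`: lower corner of an interval scalar times a scaled enclosure), **`affine2_pos`** / **`affine4_pos`**
(positivity of `v₀ + c v₃` and `v₄ − v₅ + c₃ v₃ + c_t v_t` from enclosures), `smulRatMI` (+`mem_smulRatMI`). The data and the
assembly `oddCone_of_splitΔ` are in `TaylorRegionDeltaOdd`. Elementary. [folklore]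
-/

namespace Summit.CriticalPhenomena.Ising3D

open Finset Set
open Literature.Analysis.ValidatedNumerics Literature.Analysis.ValidatedNumerics.PolyMP
open Literature.Analysis.ValidatedNumerics.NumericsMP (MI)
open Literature.MathematicalPhysics.QuantumFieldTheory.ConformalBootstrap3D

/-! ### Upper piece bound and term enclosures -/

/-- Scaled UPPER bound of an interval polynomial on `[lo, hi]` (mirror of `lowB`). [folklore] -/
def hiB (S : ℕ) (P : IPoly) (lo hi : ℚ) : ℤ :=
  let mid : ℚ := (lo + hi) / 2
  let hw : ℚ := (hi - lo) / 2
  match shiftI S P (MI.ofFrac S mid.num mid.den) with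
  | [] => 0
  | s0 :: tail => s0.hi + Numerics.cdiv (hw.num * absBoundI S hw.num hw.den tail) hw.den

/-- **`p(x)·S ≤ hiB`** on the piece. [folklore] -/
theorem le_hiB {S : ℕ} (hS : 0 < S) {P : IPoly} {lo hi : ℚ} {as : List ℝ} (has : PMem S as P)
    {x : ℝ} (hlo : (lo : ℝ) ≤ x) (hhi : x ≤ hi) : evalR as x * S ≤ (hiB S P lo hi : ℝ) := by
  set mid : ℚ := (lo + hi) / 2 with hmid
  set hw : ℚ := (hi - lo) / 2 with hhw
  have hmidR : ((mid : ℚ) : ℝ) = ((lo : ℝ) + hi) / 2 := by rw [hmid]; push_cast; ring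
  have hhwR : ((hw : ℚ) : ℝ) = ((hi : ℝ) - lo) / 2 := by rw [hhw]; push_cast; ring
  have hc : MI.mem S ((mid : ℚ) : ℝ) (MI.ofFrac S mid.num mid.den) := by
    rw [ratCast_eq_num_div_den]; exact MI.mem_ofFrac S mid.num mid.pos
  have hsh := pmem_shiftI hS hc has
  have hev : evalR as x = evalR (shiftR as ((mid : ℚ) : ℝ)) (x - mid) := by
    rw [evalR_shiftR]; congr 1; ring
  have hy : |x - mid| ≤ ((hw : ℚ) : ℝ) := by rw [hmidR, hhwR, abs_le]; constructor <;> linarith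
  have hwnn : 0 ≤ hw := by
    have : (0 : ℝ) ≤ ((hw : ℚ) : ℝ) := by rw [hhwR]; linarith
    exact_mod_cast this
  have hn0 : 0 ≤ hw.num := Rat.num_nonneg.mpr hwnn
  have hS0 : (0 : ℝ) ≤ S := by positivity
  rw [hev]
  dsimp only [hiB]
  rw [← hmid, ← hhw]
  generalize hsp : shiftI S P (MI.ofFrac S mid.num mid.den) = SP at hsh ⊢
  generalize hsr : shiftR as ((mid : ℚ) : ℝ) = SR at hsh ⊢
  match SP, SR, hsh with
  | [], [], _ => simp
  | s0 :: tail, a0 :: tR, List.Forall₂.cons ha0 htail =>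
      rw [evalR_cons]
      have hB := absBoundR_le_absBoundI (S := S) hn0 hw.pos htail
      rw [← ratCast_eq_num_div_den] at hB
      have htl := abs_evalR_le_absBoundR tR hy
      have hdz : (0 : ℤ) < hw.den := by exact_mod_cast hw.pos
      have hcd := Numerics.le_cdiv_mul_real (a := hw.num * absBoundI S hw.num hw.den tail) hdz
      have ha0m := ha0.2
      have hwR : ((hw : ℚ) : ℝ) = (hw.num : ℝ) / hw.den := ratCast_eq_num_div_den hw
      have hdR : (0 : ℝ) < hw.den := by exact_mod_cast hw.pos
      have key : ((hw : ℚ) : ℝ) * absBoundR tR ((hw : ℚ) : ℝ) * S ≤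
          ((Numerics.cdiv (hw.num * absBoundI S hw.num hw.den tail) hw.den : ℤ) : ℝ) := by
        have h5 : ((hw.num * absBoundI S hw.num hw.den tail : ℤ) : ℝ) ≤
            ((Numerics.cdiv (hw.num * absBoundI S hw.num hw.den tail) hw.den : ℤ) : ℝ) * hw.den := by
          exact_mod_cast hcd
        push_cast at h5
        have hnr : (0 : ℝ) ≤ hw.num := by exact_mod_cast hn0
        have h4 : (hw.num : ℝ) * (absBoundR tR ((hw : ℚ) : ℝ) * S) ≤ (hw.num : ℝ) * (absBoundI S hw.num hw.den tail : ℝ) :=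
          mul_le_mul_of_nonneg_left hB hnr
        rw [hwR] at h4 ⊢
        rw [div_mul_eq_mul_div, div_mul_eq_mul_div, div_le_iff₀ hdR]
        nlinarith [h4, h5]
      have hprod : |(x - mid) * evalR tR (x - mid)| ≤ ((hw : ℚ) : ℝ) * absBoundR tR ((hw : ℚ) : ℝ) := by
        rw [abs_mul]
        have hwnnR : (0 : ℝ) ≤ ((hw : ℚ) : ℝ) := by exact_mod_cast hwnn
        exact mul_le_mul hy htl (abs_nonneg _) hwnnR
      have habs := (abs_le.1 hprod).2
      have h5 : (x - mid) * evalR tR (x - mid) * S ≤ ((hw : ℚ) : ℝ) * absBoundR tR ((hw : ℚ) : ℝ) * S :=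
        mul_le_mul_of_nonneg_right habs hS0
      push_cast
      nlinarith [ha0m, h5, key]

/-- Scaled upper bound of `r₀(x) + δ r₁(x) + δ² r₂(x)` on the piece, `|δ| ≤ W`. [folklore] -/
def hiB3 (S : ℕ) (T : ITriple) (lo hi W : ℚ) : ℚ :=
  (hiB S T.1 lo hi : ℚ) + W * (absB S T.2.1 lo hi : ℚ) + W ^ 2 * (absB S T.2.2 lo hi : ℚ)

/-- [folklore] -/
theorem le_hiB3 {S : ℕ} (hS : 0 < S) {T : ITriple} {lo hi W : ℚ} (hW : 0 ≤ W) {r : List ℝ × List ℝ × List ℝ}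
    (h : PMem3 S r T) {x : ℝ} (hlo : (lo : ℝ) ≤ x) (hhi : x ≤ hi) {δ : ℝ} (hδ : |δ| ≤ W) :
    val3 r x δ * S ≤ ((hiB3 S T lo hi W : ℚ) : ℝ) := by
  have e0 := le_hiB hS h.fst hlo hhi
  have e1 := abs_le_absB hS h.snd hlo hhi
  have e2 := abs_le_absB hS h.thd hlo hhi
  have hS0 : (0 : ℝ) ≤ S := by positivity
  have hWr : (0 : ℝ) ≤ W := by exact_mod_cast hW
  have hδ0 : 0 ≤ |δ| := abs_nonneg δ
  have b1 : |δ * evalR r.2.1 x| * S ≤ (W : ℝ) * absB S T.2.1 lo hi := by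
    rw [abs_mul, mul_assoc]; exact mul_le_mul hδ e1 (by positivity) hWr
  have b2 : |δ ^ 2 * evalR r.2.2 x| * S ≤ (W : ℝ) ^ 2 * absB S T.2.2 lo hi := by
    rw [abs_mul, abs_pow, mul_assoc]
    exact mul_le_mul (pow_le_pow_left₀ hδ0 hδ 2) e2 (by positivity) (by positivity)
  have c1 := mul_le_mul_of_nonneg_right (le_abs_self (δ * evalR r.2.1 x)) hS0
  have c2 := mul_le_mul_of_nonneg_right (le_abs_self (δ ^ 2 * evalR r.2.2 x)) hS0
  rw [hiB3, val3]; push_cast; nlinarith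

/-- [folklore] -/
theorem lowB3_le' {S : ℕ} (hS : 0 < S) {T : ITriple} {lo hi W : ℚ} (hW : 0 ≤ W) {r : List ℝ × List ℝ × List ℝ}
    (h : PMem3 S r T) {x : ℝ} (hlo : (lo : ℝ) ≤ x) (hhi : x ≤ hi) {δ : ℝ} (hδ : |δ| ≤ W) :
    ((lowB3 S T lo hi W : ℚ) : ℝ) ≤ val3 r x δ * S := by
  have := lowB3_le hS hW h.fst h.snd h.thd hlo hhi hδ
  rw [val3]; exact this

/-- Lower corner of an interval scalar (scale `S`) times a scaled enclosure `[L, H]`: a lower bound of `c·v·S²`. [folklore] -/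
def mulLo (C : MI) (L H : ℚ) : ℚ :=
  min (min ((C.lo : ℚ) * L) ((C.lo : ℚ) * H)) (min ((C.hi : ℚ) * L) ((C.hi : ℚ) * H))

/-- [folklore] -/
theorem mulLo_le {S : ℕ} {c v : ℝ} {C : MI} {L H : ℚ} (hc : MI.mem S c C) (hL : (L : ℝ) ≤ v * S) (hH : v * S ≤ H) :
    ((mulLo C L H : ℚ) : ℝ) ≤ c * v * ((S : ℝ) * S) := by
  obtain ⟨hclo, hchi⟩ := hc
  set a := c * S with ha
  set b := v * S with hb
  have hab : c * v * ((S : ℝ) * S) = a * b := by rw [ha, hb]; ring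
  rw [hab, mulLo]
  push_cast
  have h1 : min ((C.lo : ℝ) * b) ((C.hi : ℝ) * b) ≤ a * b := by
    rcases le_total 0 b with hb0 | hb0
    · exact (min_le_left _ _).trans (mul_le_mul_of_nonneg_right hclo hb0)
    · exact (min_le_right _ _).trans (mul_le_mul_of_nonpos_right hchi hb0)
  have h2 : ∀ e : ℝ, min (e * L) (e * H) ≤ e * b := fun e => by
    rcases le_total 0 e with he | he
    · exact (min_le_left _ _).trans (mul_le_mul_of_nonneg_left hL he)
    · exact (min_le_right _ _).trans (mul_le_mul_of_nonpos_left hH he)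
  calc min (min ((C.lo : ℝ) * L) ((C.lo : ℝ) * H)) (min ((C.hi : ℝ) * L) ((C.hi : ℝ) * H))
      ≤ min ((C.lo : ℝ) * b) ((C.hi : ℝ) * b) := min_le_min (h2 _) (h2 _)
    _ ≤ a * b := h1

/-- `v₀ + c·v₃ > 0` from the enclosures of `v₀`, `v₃` and the interval of `c`. [folklore] -/
theorem affine2_pos {S : ℕ} (hS : 0 < S) {v0 v3 c : ℝ} {L0 L3 H3 : ℚ} {C : MI} (h0 : (L0 : ℝ) ≤ v0 * S)
    (h3L : (L3 : ℝ) ≤ v3 * S) (h3H : v3 * S ≤ H3) (hc : MI.mem S c C)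
    (hpos : 0 < L0 * (S : ℚ) + mulLo C L3 H3) : 0 < v0 + c * v3 := by
  have hm := mulLo_le hc h3L h3H
  have hSr : (0 : ℝ) < S := by exact_mod_cast hS
  have hposR : (0 : ℝ) < (L0 : ℝ) * S + (mulLo C L3 H3 : ℚ) := by exact_mod_cast hpos
  have h0S : (L0 : ℝ) * S ≤ v0 * S * S := mul_le_mul_of_nonneg_right h0 hSr.le
  have hsum : 0 < (v0 + c * v3) * ((S : ℝ) * S) := by nlinarith
  have hSS : (0 : ℝ) < (S : ℝ) * S := by positivity
  nlinarith [hsum, hSS]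

/-- `v₄ − v₅ + c₃·v₃ + c_t·v_t > 0` from the four enclosures and the two scalar intervals. [folklore] -/
theorem affine4_pos {S : ℕ} (hS : 0 < S) {v4 v5 v3 vt c3 ct : ℝ} {L4 H5 L3 H3 Lt Ht : ℚ} {C3 Ct : MI}
    (h4 : (L4 : ℝ) ≤ v4 * S) (h5 : v5 * S ≤ H5) (h3L : (L3 : ℝ) ≤ v3 * S) (h3H : v3 * S ≤ H3)
    (htL : (Lt : ℝ) ≤ vt * S) (htH : vt * S ≤ Ht) (hc3 : MI.mem S c3 C3) (hct : MI.mem S ct Ct)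
    (hpos : 0 < L4 * (S : ℚ) - H5 * (S : ℚ) + mulLo C3 L3 H3 + mulLo Ct Lt Ht) :
    0 < v4 - v5 + c3 * v3 + ct * vt := by
  have hm3 := mulLo_le hc3 h3L h3H
  have hmt := mulLo_le hct htL htH
  have hSr : (0 : ℝ) < S := by exact_mod_cast hS
  have hposR : (0 : ℝ) < (L4 : ℝ) * S - (H5 : ℝ) * S + (mulLo C3 L3 H3 : ℚ) + (mulLo Ct Lt Ht : ℚ) := by
    exact_mod_cast hpos
  have h4S : (L4 : ℝ) * S ≤ v4 * S * S := mul_le_mul_of_nonneg_right h4 hSr.le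
  have h5S : v5 * S * S ≤ (H5 : ℝ) * S := mul_le_mul_of_nonneg_right h5 hSr.le
  have hsum : 0 < (v4 - v5 + c3 * v3 + ct * vt) * ((S : ℝ) * S) := by nlinarith
  have hSS : (0 : ℝ) < (S : ℝ) * S := by positivity
  nlinarith [hsum, hSS]

/-- An interval scalar times a rational (`q · k` for `k ∈ K`). [folklore] -/
def smulRatMI (K : MI) (q : ℚ) : MI := MI.divNat (MI.mulInt K q.num) q.den

/-- [folklore] -/
theorem mem_smulRatMI {S : ℕ} {k : ℝ} {K : MI} (hk : MI.mem S k K) (q : ℚ) : MI.mem S (k * q) (smulRatMI K q) := by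
  have h := MI.mem_divNat (MI.mem_mulInt hk q.num) q.den_pos
  rw [smulRatMI]
  have hq : k * (q : ℝ) = k * (q.num : ℝ) / (q.den : ℝ) := by rw [ratCast_eq_num_div_den]; ring
  rw [hq]
  exact h

end Summit.CriticalPhenomena.Ising3D
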